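import Literature.AlgebraicGeometry.Motives.MumfordTateGroupOfCMTypeNorm
import Literature.AlgebraicGeometry.HodgeTheory.CMBettiModel
import Literature.AlgebraicGeometry.Motives.MumfordTateGroupTransport
import HarnessLib

/-!
# `MT(H¹(A; ℚ))(ℚ) ⊆ L(A)(ℚ)` for a CM abelian variety `A` of type `(K; Φ)` (Milne 1999 Prop. 2.5, `ℚ`-points)

Family `hodge`, layer `Literature/AlgebraicGeometry/HodgeTheory`, sub-namespace
`Literature.AlgebraicGeometry.HodgeTheory.CMBettiModel`.  Theorems only; no definition, no named fact.

Transport of `Motives/MumfordTateGroupOfCMTypeNorm` (`MT(V¹_{(K,Φ)})(ℚ) ⊆ {x ∈ K^× | x x̄ ∈ ℚ^×}`, Deligne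
1982 Ex. 3.7 (d) for `MT`) to the Betti carrier of a realisation `(A, ι, θ)` of the CM type `(K; Φ)`
(`ComplexMultiplication.IsCMTypeRealisation Φ A ι θ`), along the `K`-equivariant isomorphism of Hodge structures
`e : V¹_{(K,Φ)} = HodgeStructure.ofCMType Φ ≅ BettiUniverse.hodge hHD hA 1 = H¹(A(ℂ); ℚ)` of
`HodgeTheory/CMBettiModel` (`ofCMType_eq_comapEquiv`, Green–Griffiths–Kerr §V.B) and the conjugation formula
`MT(e^* H) = e⁻¹ MT(H) e` (`CMBettiModel.mem_mumfordTateGroup_hodge_iff`, `Motives/MumfordTateGroupTransport`):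

* `mem_hodgeGroup_hodge_iff` — `g ∈ Hg(H¹(A; ℚ))(ℚ) ↔ e⁻¹ g e ∈ Hg(V¹_{(K,Φ)})(ℚ)` (the `MT` version is
  `CMBettiModel.mem_mumfordTateGroup_hodge_iff`, used by name);
* `exists_eq_cmAction_of_mem_mumfordTateGroup` — **Milne 1999b Prop. 2.5 `MT(A) ⊆ L(A)` on `ℚ`-points for
  `A` of CM type `(K; Φ)`**: every `g ∈ MT(H¹(A(ℂ); ℚ))(ℚ)` (Tannaka-free group of `Motives/HodgeTensor` for the
  Betti Hodge structure `BettiUniverse.hodge hHD hA 1`) is the rational CM action `cmAction θ _ x` of some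
  `x ∈ K` with `x · x̄ = ν ∈ ℚ^×` ("`L(A_Ψ)(ℚ) = {α ∈ E_ψ^× | α · ια ∈ ℚ^×}`", "`MT(A) ⊂ L(A)`");
* `exists_eq_cmAction_of_mem_hodgeGroup` — the Hodge-group version with `x · x̄ = 1`
  (from `Motives/MumfordTateGroupOfCMType.exists_eq_mul_of_mem_hodgeGroup_ofCMType`).
* `mumfordTateGroup_hodge_comm` — `MT(H¹(A; ℚ))(ℚ)` is commutative ("`G` is a torus", on `ℚ`-points).

The instance hypotheses `[HodgeTensorFacts.{0,0}]` (tree convention for `mumfordTateGroup`; `hodgeTensorFacts_holds`)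
and `[Module.Finite ℚ (bettiCohomology A.X 1)]` (`HodgeTheory.finite_bettiCohomology_one A`, or
`BettiUniverse.finite hA 1`) are supplied by consumers with `haveI`.  `hHD : exists_isReal_hodgeModel`,
`hI : hodgePQ_independent_of_hodgeModel` are the light hypotheses of `BettiUniverseCMAction` (theorems of the tree).

## References

* [Milne1999] J. S. Milne, Lefschetz motives and the Tate conjecture, Compositio Math. 117 (1999), §2 (2.2)
  `MT(A) ⊂ L(A)` and Prop. 2.5 with proof (p. 12 of `paper:doi-10-1023-a-1000776613765`):
  "`L(A_Ψ)(ℚ) = {α ∈ E_ψ^× | α · ια ∈ ℚ^×}` and its canonical character `l(A_Ψ)` sends `α` to `α · ια`".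
* [Deligne1982HodgeCycles] P. Deligne, Hodge cycles on abelian varieties, LNM 900 (1982), I Ex. 3.7 (d), Prop. 3.4.
* [GreenGriffithsKerr2012] M. Green, P. Griffiths, M. Kerr, Mumford–Tate Groups and Domains (2012), §V.B.
-/

noncomputable section

open NumberField CategoryTheory Module

namespace Literature.AlgebraicGeometry.HodgeTheory

namespace CMBettiModel

open Literature.AlgebraicGeometry.Motives (CMType HodgeStructure AbelianVariety bettiCohomology HodgeTensorFacts)
open Literature.AlgebraicGeometry.Motives.HodgeStructure (ofCMType)
open Literature.AlgebraicGeometry.HodgeTheory.BettiUniverse (cmAction)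
open Literature.AlgebraicGeometry.ComplexMultiplication (IsCMTypeRealisation)

variable {K : Type} [Field K] [NumberField K] {Φ : CMType K} {A : AbelianVariety ℂ} {ι : 𝓞 K →+* End A}
  {θ : K →+* Module.End ℂ (complexBetti A.X 1)} [HodgeTensorFacts.{0, 0}]
  [Module.Finite ℚ (bettiCohomology A.X 1)]

/-- Read from `H¹(A)`, Hodge groups: `g′ ∈ Hg(H¹(A(ℂ); ℚ)) ↔ e⁻¹ g′ e ∈ Hg(ofCMType Φ)` — the companion of
`mem_mumfordTateGroup_hodge_iff` / `mem_hodgeGroup_ofCMType_iff` (`HodgeTheory/CMBettiModel`) read in the other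
direction (`ofCMType_eq_comapEquiv` + `HodgeStructure.mem_hodgeGroup_iff_comapEquiv`).
[cite: Deligne1982HodgeCycles, Example 3.7 and I Prop. 3.4] [cite: GreenGriffithsKerr2012, §V.B] -/
theorem mem_hodgeGroup_hodge_iff (h : IsCMTypeRealisation Φ A ι θ)
    (hHD : exists_isReal_hodgeModel) (hI : hodgePQ_independent_of_hodgeModel)
    (e : K ≃ₗ[ℚ] bettiCohomology A.X 1) (he : ∀ k x, e (k * x) = cmAction θ h.isInducedOnIntegers k (e x))
    (g' : bettiCohomology A.X 1 ≃ₗ[ℚ] bettiCohomology A.X 1) :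
    g' ∈ (BettiUniverse.hodge hHD h.1 1).hodgeGroup ↔ e.trans (g'.trans e.symm) ∈ (ofCMType Φ).hodgeGroup := by
  rw [ofCMType_eq_comapEquiv h hHD hI e he]
  exact HodgeStructure.mem_hodgeGroup_iff_comapEquiv _ e g'

omit [HodgeTensorFacts.{0, 0}] [Module.Finite ℚ (bettiCohomology A.X 1)] in
/-- Reading `e⁻¹ g e = (x ·)` on `K` back on `H¹(A; ℚ)`: `g = cmAction x` (surjectivity of `e` and its
equivariance). [folklore] -/
private theorem eq_cmAction_of_trans_trans_symm_eq_mul (h : IsCMTypeRealisation Φ A ι θ)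
    (e : K ≃ₗ[ℚ] bettiCohomology A.X 1) (he : ∀ k x, e (k * x) = cmAction θ h.isInducedOnIntegers k (e x))
    {g : bettiCohomology A.X 1 ≃ₗ[ℚ] bettiCohomology A.X 1} {x : K}
    (hx : ∀ v, e.trans (g.trans e.symm) v = x * v) (w : bettiCohomology A.X 1) :
    g w = cmAction θ h.isInducedOnIntegers x w := by
  obtain ⟨v, rfl⟩ := e.surjective w
  have h1 := hx v
  simp only [LinearEquiv.trans_apply] at h1
  -- `h1 : e.symm (g (e v)) = x * v`
  rw [← he, ← h1, LinearEquiv.apply_symm_apply]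

/-- **Milne 1999b Prop. 2.5 `MT(A) ⊆ L(A)`, on `ℚ`-points, for `A` a realisation of the CM type `(K; Φ)`**:
every element `g` of the (Tannaka-free) Mumford–Tate group of the rational Hodge structure `H¹(A(ℂ); ℚ)` is the
rational CM action of some `x ∈ K` whose norm to the maximal real subfield is RATIONAL and non-zero,
`x · x̄ = ν ∈ ℚ^×` — "`L(A_Ψ)` is the subtorus of `(𝔾_m)_{E_ψ/ℚ}` such that
`L(A_Ψ)(ℚ) = {α ∈ E_ψ^× | α · ια ∈ ℚ^×}`", `MT(A) ⊂ L(A)` ((2.2)).  Deligne Ex. 3.7 (d):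
"`G(ℚ) ⊂ {(x, y) ∈ E^× × ℚ^× | Nm_{E/F}(x) ∈ ℚ^×}`". [cite: Milne1999, Prop. 2.5] [cite: Deligne1982HodgeCycles, I Ex. 3.7 (d)] -/
theorem exists_eq_cmAction_of_mem_mumfordTateGroup [IsCMField K] (h : IsCMTypeRealisation Φ A ι θ)
    (hHD : exists_isReal_hodgeModel) (hI : hodgePQ_independent_of_hodgeModel)
    {g : bettiCohomology A.X 1 ≃ₗ[ℚ] bettiCohomology A.X 1}
    (hg : g ∈ (BettiUniverse.hodge hHD h.1 1).mumfordTateGroup) :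
    ∃ (x : K) (ν : ℚ), ν ≠ 0 ∧ x * IsCMField.complexConj K x = algebraMap ℚ K ν ∧
      ∀ w, g w = cmAction θ h.isInducedOnIntegers x w := by
  obtain ⟨e, he, -⟩ := exists_ofCMType_eq_comapEquiv h hHD hI
  obtain ⟨x, ν, hν, hx, hgx⟩ := HodgeStructure.exists_eq_mul_of_mem_mumfordTateGroup_ofCMType Φ
    ((mem_mumfordTateGroup_hodge_iff h hHD hI e he g).1 hg)
  exact ⟨x, ν, hν, hx, eq_cmAction_of_trans_trans_symm_eq_mul h e he hgx⟩

/-- **`Hg(A) ⊆ ker l` on `ℚ`-points for `A` of CM type `(K; Φ)`**: every element of the Hodge group of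
`H¹(A(ℂ); ℚ)` is the rational CM action of some `x ∈ K` with `x · x̄ = 1` (Milne: the kernel of the canonical
character `l(A_Ψ) : α ↦ α · ια`; Deligne Ex. 3.7 (d) with constant `0`).
[cite: Milne1999, Prop. 2.5] [cite: Deligne1982HodgeCycles, I Ex. 3.7 (d)] -/
theorem exists_eq_cmAction_of_mem_hodgeGroup [IsCMField K] (h : IsCMTypeRealisation Φ A ι θ)
    (hHD : exists_isReal_hodgeModel) (hI : hodgePQ_independent_of_hodgeModel)
    {g : bettiCohomology A.X 1 ≃ₗ[ℚ] bettiCohomology A.X 1}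
    (hg : g ∈ (BettiUniverse.hodge hHD h.1 1).hodgeGroup) :
    ∃ x : K, x * IsCMField.complexConj K x = 1 ∧ ∀ w, g w = cmAction θ h.isInducedOnIntegers x w := by
  obtain ⟨e, he, -⟩ := exists_ofCMType_eq_comapEquiv h hHD hI
  obtain ⟨x, hx, hgx⟩ := HodgeStructure.exists_eq_mul_of_mem_hodgeGroup_ofCMType Φ
    ((mem_hodgeGroup_hodge_iff h hHD hI e he g).1 hg)
  exact ⟨x, hx, eq_cmAction_of_trans_trans_symm_eq_mul h e he hgx⟩

/-- Without the CM-field hypothesis (only `MT(ℚ) ⊆ K^×`, Deligne Ex. 3.7 "`G ⊂ E^× × ℚ^×`"): every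
`g ∈ MT(H¹(A; ℚ))(ℚ)` is the rational CM action of some `x ∈ K`, `g = cmAction x` (`K` any number field
carrying the realisation).
[cite: Deligne1982HodgeCycles, I Ex. 3.7] -/
theorem exists_eq_cmAction_of_mem_mumfordTateGroup' (h : IsCMTypeRealisation Φ A ι θ)
    (hHD : exists_isReal_hodgeModel) (hI : hodgePQ_independent_of_hodgeModel)
    {g : bettiCohomology A.X 1 ≃ₗ[ℚ] bettiCohomology A.X 1}
    (hg : g ∈ (BettiUniverse.hodge hHD h.1 1).mumfordTateGroup) :
    ∃ x : K, ∀ w, g w = cmAction θ h.isInducedOnIntegers x w := by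
  obtain ⟨e, he, -⟩ := exists_ofCMType_eq_comapEquiv h hHD hI
  have hg' := (mem_mumfordTateGroup_hodge_iff h hHD hI e he g).1 hg
  exact ⟨_, eq_cmAction_of_trans_trans_symm_eq_mul h e he
    (HodgeStructure.mumfordTateGroup_ofCMType_apply Φ hg')⟩

/-- **`MT(A)(ℚ)` is commutative for `A` of CM type** ("In particular, `G` is a torus", Deligne Ex. 3.7): any two
elements of `MT(H¹(A(ℂ); ℚ))(ℚ)` commute, both being rational CM actions `cmAction x` of elements of the
(commutative) field `K`. [cite: Deligne1982HodgeCycles, I Ex. 3.7] -/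
theorem mumfordTateGroup_hodge_comm (h : IsCMTypeRealisation Φ A ι θ)
    (hHD : exists_isReal_hodgeModel) (hI : hodgePQ_independent_of_hodgeModel)
    {g₁ g₂ : bettiCohomology A.X 1 ≃ₗ[ℚ] bettiCohomology A.X 1}
    (hg₁ : g₁ ∈ (BettiUniverse.hodge hHD h.1 1).mumfordTateGroup)
    (hg₂ : g₂ ∈ (BettiUniverse.hodge hHD h.1 1).mumfordTateGroup) : g₁ * g₂ = g₂ * g₁ := by
  obtain ⟨x₁, hx₁⟩ := exists_eq_cmAction_of_mem_mumfordTateGroup' h hHD hI hg₁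
  obtain ⟨x₂, hx₂⟩ := exists_eq_cmAction_of_mem_mumfordTateGroup' h hHD hI hg₂
  refine LinearEquiv.ext fun w => ?_
  change g₁ (g₂ w) = g₂ (g₁ w)
  rw [hx₂ w, hx₁, hx₁ w, hx₂, ← Module.End.mul_apply, ← map_mul, ← Module.End.mul_apply, ← map_mul,
    mul_comm]

end CMBettiModel

end Literature.AlgebraicGeometry.HodgeTheory

end
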